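import Literature.Topology.FourManifolds.IsotopyExtensionSupport
import Literature.Topology.FourManifolds.ImmersionCriterion
import Literature.Topology.FourManifolds.KnotFraming
import Mathlib.Geometry.Manifold.Instances.Sphere
import HarnessLib

/-!
# Isotopy extension in Euclidean space: a smooth isotopy of a compact submanifold of `ℝᵏ⁺¹`
# ends at the image of its start under a diffeomorphism of `ℝᵏ⁺¹`

Topic `Literature/Topology/FourManifolds`; a corollary of the tree's isotopy extension theorem
with support (`Literature.Topology.FourManifolds.exists_ambientIsotopy_comp_eq_of_subset`,
`IsotopyExtensionSupport.lean`: Milnor, *Lectures on the h-cobordism theorem* (1965), Thm. 5.8;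
Hirsch, *Differential Topology* (1976), Ch. 8 §1, Thm. 1.3), which is stated there for a
**compact** ambient manifold.  Written for the fact seat of
`Literature.Geometry.Riemannian.Sweeney2026_pscMeanConvex` (Lawson–Michelsohn's strong isotopy of the
boundary of a compact domain of `ℝ^{m+1}` has to be realised by an ambient diffeomorphism).
Everything here is **proved**.

* `exists_diffeomorph_comp_eq_of_smoothIsotopy_euclidean` — if `F` is a smooth isotopy
  (`Literature.Topology.FourManifolds.SmoothIsotopy`) from `f` to `g`, maps of a compact
  boundaryless manifold `M` into `ℝᵏ⁺¹`, then `g = θ ∘ f` for a diffeomorphism `θ` of `ℝᵏ⁺¹`.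

Proof (one-point compactification, smoothly): let `S = Sᵏ⁺¹ ⊂ ℝᵏ⁺²` be the round sphere and
`c` its stereographic chart at a point `v₀` (Mathlib's `chartAt`, source `S ∖ {-v₀}`, target all
of `ℝᵏ⁺¹`), so that `ι = c⁻¹ : ℝᵏ⁺¹ → S` is a diffeomorphism onto `S ∖ {-v₀}`.  Then `ι ∘ F_t` is a
smooth isotopy of `M` in the compact manifold `S` whose tracks stay in the open set `S ∖ {-v₀}`,
so the isotopy extension theorem with support gives an ambient isotopy `Ψ_t` of `S` with
`Ψ_t ∘ ι ∘ f = ι ∘ F_t` and `Ψ_t (-v₀) = -v₀`; the diffeomorphism `Ψ₁` preserves `S ∖ {-v₀}` and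
`θ = c ∘ Ψ₁ ∘ ι` is the required diffeomorphism of `ℝᵏ⁺¹` (Hirsch, *loc. cit.*, Thm. 1.3 is
stated for arbitrary, not necessarily compact, ambient manifolds; the compact support of the
extension is not recorded here).

## References

* M. W. Hirsch, *Differential Topology*, GTM 33 (1976), Ch. 8 §1, Thms. 1.3–1.4. [HirschDT1976]
* J. Milnor, *Lectures on the h-cobordism theorem* (1965), Thm. 5.8. [MilnorHCobordism1965]
-/

noncomputable section

open Set Function Metric Module
open scoped Manifold ContDiff Topology

namespace Literature.Topology.FourManifolds

variable {k : ℕ}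

/-! ### The stereographic parametrisation of the sphere minus a point by `ℝᵏ⁺¹` -/

section Stereo

variable (k)

/-- A base point of the unit sphere `Sᵏ⁺¹ ⊂ ℝᵏ⁺²` (the first coordinate vector). [folklore] -/
def spherePoint : sphere (0 : EuclideanSpace ℝ (Fin (k + 1 + 1))) 1 :=
  ⟨EuclideanSpace.single 0 1, by simp⟩

open scoped EuclideanSpace in
/-- The stereographic chart of `Sᵏ⁺¹` at the base point (Mathlib's preferred chart there: source
the complement of the antipode, target all of `ℝᵏ⁺¹`). [folklore] -/
def polarStereoChart : OpenPartialHomeomorph (sphere (0 : EuclideanSpace ℝ (Fin (k + 1 + 1))) 1)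
    (EuclideanSpace ℝ (Fin (k + 1))) :=
  chartAt (EuclideanSpace ℝ (Fin (k + 1))) (spherePoint k)

/-- The target of the stereographic chart is all of `ℝᵏ⁺¹`. [folklore] -/
theorem polarStereoChart_target : (polarStereoChart k).target = univ := by
  haveI : Fact (finrank ℝ (EuclideanSpace ℝ (Fin (k + 1 + 1))) = k + 1 + 1) :=
    ⟨finrank_euclideanSpace_fin⟩
  exact stereographic'_target (-(spherePoint k))

variable {k}

/-- Every point of `ℝᵏ⁺¹` lies in the target of the stereographic chart. [folklore] -/
theorem mem_polarStereoChart_target (y : EuclideanSpace ℝ (Fin (k + 1))) :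
    y ∈ (polarStereoChart k).target := by
  rw [polarStereoChart_target]; exact mem_univ y

/-- The inverse stereographic parametrisation takes values in the chart domain. [folklore] -/
theorem polarStereoChart_symm_mem_source (y : EuclideanSpace ℝ (Fin (k + 1))) :
    (polarStereoChart k).symm y ∈ (polarStereoChart k).source :=
  (polarStereoChart k).map_target (mem_polarStereoChart_target y)

/-- `c (c⁻¹ y) = y` for the stereographic chart `c`, every `y ∈ ℝᵏ⁺¹`. [folklore] -/
@[simp] theorem polarStereoChart_apply_symm (y : EuclideanSpace ℝ (Fin (k + 1))) :
    polarStereoChart k ((polarStereoChart k).symm y) = y :=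
  (polarStereoChart k).right_inv (mem_polarStereoChart_target y)

/-- The inverse stereographic parametrisation `ℝᵏ⁺¹ → Sᵏ⁺¹` is injective. [folklore] -/
theorem injective_polarStereoChart_symm : Injective (polarStereoChart k).symm := fun a b h => by
  simpa using congrArg (polarStereoChart k) h

open scoped EuclideanSpace in
/-- The inverse stereographic parametrisation `ℝᵏ⁺¹ → Sᵏ⁺¹` is smooth. [folklore] -/
theorem contMDiff_polarStereoChart_symm :
    ContMDiff (𝓡 (k + 1)) (𝓡 (k + 1)) ∞ (polarStereoChart k).symm := by
  have h := contMDiffOn_chart_symm (I := 𝓡 (k + 1)) (n := ∞) (x := spherePoint k)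
  rw [show chartAt (EuclideanSpace ℝ (Fin (k + 1))) (spherePoint k) = polarStereoChart k from rfl,
    polarStereoChart_target] at h
  exact contMDiffOn_univ.1 h

open scoped EuclideanSpace in
/-- The stereographic chart is smooth on its domain. [folklore] -/
theorem contMDiffOn_polarStereoChart :
    ContMDiffOn (𝓡 (k + 1)) (𝓡 (k + 1)) ∞ (polarStereoChart k) (polarStereoChart k).source :=
  contMDiffOn_chart (I := 𝓡 (k + 1)) (n := ∞) (x := spherePoint k)

open scoped EuclideanSpace in
/-- The differential of the inverse stereographic parametrisation is injective at every point
(it is the inverse of a chart). [folklore] -/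
theorem mfderiv_polarStereoChart_symm_injective (y : EuclideanSpace ℝ (Fin (k + 1))) :
    Injective (mfderiv (𝓡 (k + 1)) (𝓡 (k + 1)) (polarStereoChart k).symm y) :=
  (mdifferentiable_chart (I := 𝓡 (k + 1)) (spherePoint k)).symm.mfderiv_injective
    (by rw [OpenPartialHomeomorph.symm_source]; exact mem_polarStereoChart_target y)

end Stereo

/-! ### Transport of a smooth isotopy into the sphere -/

section Transport

variable {EM : Type*} [NormedAddCommGroup EM] [NormedSpace ℝ EM] [FiniteDimensional ℝ EM]
  {HM : Type*} [TopologicalSpace HM] {I : ModelWithCorners ℝ EM HM} [I.Boundaryless]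
  {M : Type*} [TopologicalSpace M] [ChartedSpace HM M] [IsManifold I ∞ M] [CompactSpace M]

open scoped EuclideanSpace in
/-- **A smooth isotopy in `ℝᵏ⁺¹`, read in the sphere `Sᵏ⁺¹` through the inverse stereographic
parametrisation, is a smooth isotopy**: the stages `ι ∘ F_t` are injective with injective
differential (chain rule), hence smooth embeddings of the compact `M` (the tree's
`isSmoothEmbedding_of_injective_of_injective_mfderiv`). [cite: HirschDT1976, Ch. 8 §1] -/
def SmoothIsotopy.stereo {f g : M → EuclideanSpace ℝ (Fin (k + 1))}
    (F : SmoothIsotopy I (𝓡 (k + 1)) f g) :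
    SmoothIsotopy I (𝓡 (k + 1)) ((polarStereoChart k).symm ∘ f) ((polarStereoChart k).symm ∘ g) where
  toFun t := (polarStereoChart k).symm ∘ F.toFun t
  contMDiff := contMDiff_polarStereoChart_symm.comp F.contMDiff
  isSmoothEmbedding t := by
    have hFt : ContMDiff I (𝓡 (k + 1)) ∞ (F.toFun t) := (F.isSmoothEmbedding t).contMDiff
    have hst : ContMDiff I (𝓡 (k + 1)) ∞ ((polarStereoChart k).symm ∘ F.toFun t) :=
      contMDiff_polarStereoChart_symm.comp hFt
    refine isSmoothEmbedding_of_injective_of_injective_mfderiv hst (by exact_mod_cast le_top)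
      (injective_polarStereoChart_symm.comp (F.isSmoothEmbedding t).isEmbedding.injective) fun x => ?_
    rw [mfderiv_comp x (contMDiff_polarStereoChart_symm.mdifferentiableAt (by simp))
      (hFt.mdifferentiableAt (by simp))]
    have h1 : Injective (mfderiv I (𝓡 (k + 1)) (F.toFun t) x) :=
      Manifold.IsImmersionAt.mfderiv_injective ((F.isSmoothEmbedding t).isImmersion.isImmersionAt x)
        (by simp)
    exact (mfderiv_polarStereoChart_symm_injective (F.toFun t x)).comp h1
  map_zero := by rw [F.map_zero]
  map_one := by rw [F.map_one]

/-- Stages of the transported isotopy (definitional). [folklore] -/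
@[simp] theorem SmoothIsotopy.stereo_toFun {f g : M → EuclideanSpace ℝ (Fin (k + 1))}
    (F : SmoothIsotopy I (𝓡 (k + 1)) f g) (t : ℝ) :
    (F.stereo).toFun t = (polarStereoChart k).symm ∘ F.toFun t := rfl

end Transport

/-! ### The Euclidean isotopy extension theorem -/

section Extension

variable {EM : Type*} [NormedAddCommGroup EM] [NormedSpace ℝ EM] [FiniteDimensional ℝ EM]
  {HM : Type*} [TopologicalSpace HM] {I : ModelWithCorners ℝ EM HM} [I.Boundaryless]
  {M : Type*} [TopologicalSpace M] [ChartedSpace HM M] [IsManifold I ∞ M] [CompactSpace M]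

open scoped EuclideanSpace in
/-- **Isotopy extension in `ℝᵏ⁺¹`.**  If `f, g : M → ℝᵏ⁺¹` are smoothly isotopic maps of a
compact boundaryless manifold `M` (over a finite-dimensional boundaryless model), there is a
diffeomorphism `θ` of `ℝᵏ⁺¹` with `θ ∘ f = g`.  Proof: transport the isotopy into the compact
sphere `Sᵏ⁺¹` by the inverse stereographic parametrisation `ι`, extend it there to an ambient
isotopy `Ψ` fixing the missing point (the tree's
`exists_ambientIsotopy_comp_eq_of_subset`, Milnor 1965 Thm. 5.8 / Hirsch Ch. 8 Thm. 1.3 with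
support in the chart domain), and conjugate `Ψ₁` back: `θ = c ∘ Ψ₁ ∘ ι`.
[cite: HirschDT1976, Ch. 8 §1, Thm. 1.3] [cite: MilnorHCobordism1965, Thm. 5.8] -/
theorem exists_diffeomorph_comp_eq_of_smoothIsotopy_euclidean
    {f g : M → EuclideanSpace ℝ (Fin (k + 1))} (F : SmoothIsotopy I (𝓡 (k + 1)) f g) :
    ∃ θ : EuclideanSpace ℝ (Fin (k + 1)) ≃ₘ⟮𝓡 (k + 1), 𝓡 (k + 1)⟯
      EuclideanSpace ℝ (Fin (k + 1)), θ ∘ f = g := by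
  haveI : CompleteSpace EM := FiniteDimensional.complete ℝ EM
  set c := polarStereoChart k with hc
  -- extend the transported isotopy inside the chart domain of the sphere
  obtain ⟨Ψ, hΨ, hfix⟩ := exists_ambientIsotopy_comp_eq_of_subset F.stereo c.open_source
    (fun t x => polarStereoChart_symm_mem_source (F.toFun t x))
  set ψ := Ψ.toDiffeomorph 1 with hψ
  -- `ψ` and `ψ⁻¹` preserve the chart domain (they fix its complement pointwise)
  have hψfix : ∀ y, y ∉ c.source → ψ y = y := fun y hy => hfix 1 y hy
  have hψsrc : ∀ y, y ∈ c.source → ψ y ∈ c.source := by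
    intro y hy
    by_contra h
    have h1 : ψ y = y := ψ.injective (hψfix _ h)
    rw [h1] at h
    exact h hy
  have hψsrc' : ∀ y, y ∈ c.source → ψ.symm y ∈ c.source := by
    intro y hy
    by_contra h
    have h1 : ψ (ψ.symm y) = ψ.symm y := hψfix _ h
    rw [Diffeomorph.apply_symm_apply] at h1
    rw [← h1] at h
    exact h hy
  -- the conjugated maps
  set θf : EuclideanSpace ℝ (Fin (k + 1)) → EuclideanSpace ℝ (Fin (k + 1)) :=
    fun y => c (ψ (c.symm y)) with hθf
  set θi : EuclideanSpace ℝ (Fin (k + 1)) → EuclideanSpace ℝ (Fin (k + 1)) :=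
    fun y => c (ψ.symm (c.symm y)) with hθi
  have hleft : ∀ y, θi (θf y) = y := by
    intro y
    simp only [hθf, hθi]
    rw [c.left_inv (hψsrc _ (polarStereoChart_symm_mem_source y)), Diffeomorph.symm_apply_apply,
      polarStereoChart_apply_symm]
  have hright : ∀ y, θf (θi y) = y := by
    intro y
    simp only [hθf, hθi]
    rw [c.left_inv (hψsrc' _ (polarStereoChart_symm_mem_source y)), Diffeomorph.apply_symm_apply,
      polarStereoChart_apply_symm]
  have hθf_smooth : ContMDiff (𝓡 (k + 1)) (𝓡 (k + 1)) ∞ θf :=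
    contMDiffOn_polarStereoChart.comp_contMDiff (ψ.contMDiff.comp contMDiff_polarStereoChart_symm)
      fun y => hψsrc _ (polarStereoChart_symm_mem_source y)
  have hθi_smooth : ContMDiff (𝓡 (k + 1)) (𝓡 (k + 1)) ∞ θi :=
    contMDiffOn_polarStereoChart.comp_contMDiff (ψ.symm.contMDiff.comp contMDiff_polarStereoChart_symm)
      fun y => hψsrc' _ (polarStereoChart_symm_mem_source y)
  refine ⟨⟨⟨θf, θi, hleft, hright⟩, hθf_smooth, hθi_smooth⟩, funext fun x => ?_⟩
  -- `θ (f x) = c (Ψ₁ (ι (f x))) = c (ι (g x)) = g x`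
  show c (ψ (c.symm (f x))) = g x
  have h1 : Ψ.toFun 1 ((polarStereoChart k).symm (f x)) = (polarStereoChart k).symm (g x) := by
    have := congrFun (hΨ 1 ⟨zero_le_one, le_rfl⟩) x
    simpa [F.map_one] using this
  rw [hψ, AmbientIsotopy.coe_toDiffeomorph, ← hc] at *
  rw [h1, polarStereoChart_apply_symm]

end Extension

end Literature.Topology.FourManifolds

end
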